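import Literature.NumberTheory.LFunctions.RHClassicalEquivalentsRobinProofs
import HarnessLib

/-!
# Splittings — Robin finite lens, E3 (the CA Mertens certificate re-read with window hypotheses), part 1/6, §A

Cell rh-split, seat rh-split-robin-finite g7 (brief sha16 f79c5f09d8bcb036), card `run/shared/lean/pub/rh-split/cards/SPLIT-robin-finite.md` §14
(referee rh-split-ref g3 REFEREE ADDENDUM (robin, finite) §14 DELIVERABLE + REPLAY ×2 2026-08-27T05:39:31Z; lead rh-split-lead g3 RULING #24:
zero-def variant of record); cut of `HOME/rh-split-robin-finite/SketchG7-E3-zerodef.lean` (sha16 c3a3285c0daab218, 1644 l, 52 thms, ZERO defs —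
generated by the seat from SketchG7-E3.lean deb49c670b0d4cda by spelling out `ThetaWindow` / `EBoxOn` / `Eb` / `budgetPT`) into SIX files
(`RobinFiniteE3Window` §A, `…Combine` §B, `…Cells` §C, `…Large` §D, `…Error` §E, `…Main` §F; the card's five-file plan puts §A+§B in one
file, which is 428 l > the 400-line rule), filed by rh-split-typer-1 g4.  Decl blocks byte-identical to the scratch; one namespace
`…Theorems.Splittings.RobinFiniteE3` (scratch: `…Splittings.RobinFinite.E3Z`).

This part — part 1/6, §A: Schoenfeld's bound on a WINDOW `[599, B]` and the `G₂`/`G₁` boxes re-read (`theta_two_sidedW`, `G2_lowerW`, `G2_mul_geW`,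
`G1_mul_geW`, …: the Sharp file's lemmas with `(hS) (hRH)` ↦ `(hW) (· ≤ B)`).  RH-free; imports Literature only.

E3 of the card's exchange lemma = the MECHANICAL RE-READ of the tree's CA Mertens certificate `RobinAnalyticSharp.mertens_prod_lt_RH`
with its two RH uses replaced: (θ) Schoenfeld's `|θ t − t| ≤ √t log² t/(8π)` by a WINDOW hypothesis `∀ y ∈ [599, B], |θ y − y| ≤ √y log² y/(8π)`
(spelled out), and (f) Nicolas's `−log f(P) ≤ E_RH(P)` by an ABSTRACT error value / function, so that the tree's RH-free inputs
`RobinFiniteE1c.schoenfeldThetaOn_of_buthe2016` and `RobinFiniteTail(Free).nicolasLowerBetween_PT_tailFree` plug in (in `…Main`).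
No new analytic idea: every proof is the tree's, with `hS hRH` ↦ `hW … (t ≤ B)` and `nicolasERH_mul_le` ↦ a hypothesis.
HONEST LABEL: «SPLITTING SEARCH over kernel-typed RH-EQUIVALENCES; a splitting A ∧ B ⟹ RH is CONDITIONAL bookkeeping
unless A and B are both proved; nothing here bears on the truth of RH.»  Referee labels: class (robin, finite) UNCHANGED (RELABELLING ×4,
tail-rigid); the conditional headline's modulo-list is PRINT-ONLY {Buthe2016_thm2, Buthe2018_thm2_theta, BroadbentEtAl2021_theta_rel_1e19, RH(H₀)}.
-/

set_option linter.dupNamespace false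

noncomputable section

open Real Filter Finset
open scoped Chebyshev

namespace Summit.RiemannHypothesis.RiemannHypothesis.Theorems.Splittings.RobinFiniteE3

open Literature.NumberTheory.LFunctions
open RobinAnalyticSharp

/-! ## §A · Schoenfeld's bound on a window `[599, B]`; the `G₂`/`G₁` boxes re-read -/

/- (spelled out, was a def)  The `θ`-window on `[599, B]`: `|θ y − y| ≤ √y log² y/(8π)` for `599 ≤ y ≤ B` (the shape delivered RH-free up to
`B = 2.169·10²⁵` by `RobinFiniteE1c.schoenfeldThetaOn_of_buthe2016`). -/
/-- RH's global bound restricts to every window (sanity: the tree's route is an instance). -/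
theorem thetaWindow_of_rh (hS : Schoenfeld1976_theta) (hRH : RiemannHypothesis) (B : ℝ) : (∀ y : ℝ, 599 ≤ y → y ≤ B → |θ y - y| ≤ √y * Real.log y ^ 2 / (8 * π)) :=
  fun y hy _ => hS hRH y hy

/-- `abs_theta_sub_le` on the window. -/
theorem abs_theta_sub_leW {B t : ℝ} (hW : (∀ y : ℝ, 599 ≤ y → y ≤ B → |θ y - y| ≤ √y * Real.log y ^ 2 / (8 * π))) (ht : 599 ≤ t) (htB : t ≤ B) :
    |θ t - t| ≤ schoenfeldDelta t * t := by
  have h := hW t ht htB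
  have ht0 : 0 < t := by linarith
  have e : √t * Real.log t ^ 2 / (8 * π) = schoenfeldDelta t * t := by
    unfold schoenfeldDelta
    have hs : 0 < √t := Real.sqrt_pos.2 ht0
    have hst : √t * √t = t := Real.mul_self_sqrt ht0.le
    field_simp
    nlinarith [hst]
  rwa [e] at h

/-- `theta_two_sided` on the window: on `[Q, t]` with `599 ≤ Q ≤ t ≤ B`, `(1 − δ(Q)) t ≤ θ(t) ≤ (1 + δ(Q)) t`. -/
theorem theta_two_sidedW {B Q t : ℝ} (hW : (∀ y : ℝ, 599 ≤ y → y ≤ B → |θ y - y| ≤ √y * Real.log y ^ 2 / (8 * π))) (hQ : 599 ≤ Q) (hQt : Q ≤ t) (htB : t ≤ B) :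
    (1 - schoenfeldDelta Q) * t ≤ θ t ∧ θ t ≤ (1 + schoenfeldDelta Q) * t := by
  have ht : 599 ≤ t := hQ.trans hQt
  have ht0 : 0 ≤ t := by linarith
  have h := abs_le.1 (abs_theta_sub_leW hW ht htB)
  have hmono : schoenfeldDelta t * t ≤ schoenfeldDelta Q * t :=
    mul_le_mul_of_nonneg_right (schoenfeldDelta_antitone hQ hQt) ht0
  constructor <;> nlinarith [h.1, h.2]

/-- `G2_lower` on the window (`PrimeSquareTail.le_sum_inv_sq` fed with `theta_two_sidedW`; all `θ`-points lie in
`[Q, P] ⊆ [599, B]`). -/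
theorem G2_lowerW {B : ℝ} (hW : (∀ y : ℝ, 599 ≤ y → y ≤ B → |θ y - y| ≤ √y * Real.log y ^ 2 / (8 * π))) {Q P : ℕ} (hQ : 599 ≤ Q) (hQP : Q ≤ P) (hPB : (P : ℝ) ≤ B) :
    (1 - schoenfeldDelta Q) * (Real.log Q / (Real.log Q + 1)) *
          (1 / ((Q : ℝ) * Real.log Q) - 1 / ((P : ℝ) * Real.log P))
        - 2 * schoenfeldDelta Q / ((Q : ℝ) * Real.log Q) ≤
      ∑ p ∈ (Nat.primesLE P).filter (fun p => Q < p), ((p : ℝ) ^ 2)⁻¹ := by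
  have hQr : (599 : ℝ) ≤ Q := by exact_mod_cast hQ
  have hQPr : (Q : ℝ) ≤ P := by exact_mod_cast hQP
  have h := Literature.NumberTheory.LFunctions.PrimeSquareTail.le_sum_inv_sq (Q := (Q : ℝ)) (P := (P : ℝ))
    (δ := schoenfeldDelta Q) (by linarith) hQPr ((schoenfeldDelta_le hQr).trans (by norm_num))
    (fun t ht => (theta_two_sidedW hW hQr ht.1 (ht.2.trans hPB)).1)
    (theta_two_sidedW hW hQr le_rfl (hQPr.trans hPB)).2
  rwa [Nat.floor_natCast, Nat.floor_natCast, ← filter_primesLE_eq] at h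

/-- `G2_mul_ge` on the window (proof verbatim, `G2_lower` ↦ `G2_lowerW`). -/
theorem G2_mul_geW {B : ℝ} (hW : (∀ y : ℝ, 599 ≤ y → y ≤ B → |θ y - y| ≤ √y * Real.log y ^ 2 / (8 * π))) {P Q : ℕ}
    {P₁ a₁ a₂ d₁ ℓ₁ L₁ s₁ mlow : ℝ}
    (hQ : 599 ≤ Q) (hQP : Q ≤ P) (hPB : (P : ℝ) ≤ B) (hPl : P₁ ≤ P) (hP₁ : 599 ≤ P₁)
    (ha₁ : a₁ * √(P : ℝ) ≤ Q) (ha₂ : (Q : ℝ) ≤ a₂ * √(P : ℝ)) (ha₁0 : 0 ≤ a₁) (ha₂0 : 0 < a₂)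
    (hd₁ : schoenfeldDelta (max 599 (a₁ * √P₁)) ≤ d₁) (hd₁1 : d₁ ≤ 1 / 2)
    (hℓ₁ : ℓ₁ ≤ Real.log (max 599 (a₁ * √P₁))) (hℓ₁0 : 0 < ℓ₁)
    (hL₁ : L₁ ≤ Real.log P₁) (hs₁ : s₁ ≤ √P₁) (hs₁0 : 0 < s₁)
    (hm0 : 0 ≤ mlow) (hm : ∀ L : ℝ, L₁ ≤ L → mlow * (a₂ * (Real.log a₂ + L / 2)) ≤ L)
    (hκ : 0 ≤ (1 - d₁) * (ℓ₁ / (ℓ₁ + 1)) - 2 * d₁) :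
    g2Box d₁ ℓ₁ mlow s₁ ≤
      (∑ p ∈ (Nat.primesLE P).filter (fun p => Q < p), ((p : ℝ) ^ 2)⁻¹) * (√(P : ℝ) * Real.log P) := by
  have hQr : (599 : ℝ) ≤ Q := by exact_mod_cast hQ
  have hQPr : (Q : ℝ) ≤ P := by exact_mod_cast hQP
  have hP0 : (0 : ℝ) < P := by linarith
  have hP₁0 : 0 < P₁ := by linarith
  have hQ0 : (0 : ℝ) < Q := by linarith
  set L := Real.log (P : ℝ) with hL
  set s := √(P : ℝ) with hs
  set ℓ := Real.log (Q : ℝ) with hℓ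
  set δ := schoenfeldDelta Q with hδ
  have hs0 : 0 < s := Real.sqrt_pos.2 hP0
  have hss : s * s = P := Real.mul_self_sqrt hP0.le
  have hlogs : Real.log s = L / 2 := by rw [hs, Real.log_sqrt hP0.le]
  have hℓpos : 0 < ℓ := Real.log_pos (by linarith)
  have hLpos : 0 < L := Real.log_pos (by linarith)
  have hLl : L₁ ≤ L := hL₁.trans (Real.log_le_log hP₁0 hPl)
  have hsl : s₁ ≤ s := hs₁.trans (Real.sqrt_le_sqrt hPl)
  -- `δ ≤ d₁`, `ℓ ≥ ℓ₁`
  have hmaxQ : max 599 (a₁ * √P₁) ≤ Q := by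
    refine max_le hQr (le_trans ?_ ha₁)
    exact mul_le_mul_of_nonneg_left (Real.sqrt_le_sqrt hPl) ha₁0
  have hδd : δ ≤ d₁ := (schoenfeldDelta_antitone (le_max_left _ _) hmaxQ).trans hd₁
  have hδ0 : 0 ≤ δ := schoenfeldDelta_nonneg _
  have hℓl : ℓ₁ ≤ ℓ := hℓ₁.trans (Real.log_le_log (lt_of_lt_of_le (by norm_num) (le_max_left _ _)) hmaxQ)
  -- the tail bound
  have hG := G2_lowerW hW hQ hQP hPB
  rw [← hδ] at hG
  set S := ∑ p ∈ (Nat.primesLE P).filter (fun p => Q < p), ((p : ℝ) ^ 2)⁻¹ with hSdef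
  -- `m = sL/(Qℓ) ≥ mlow`
  set m := s * L / ((Q : ℝ) * ℓ) with hmdef
  have hm_ge : mlow ≤ m := by
    have h1 : ℓ ≤ Real.log a₂ + L / 2 := by
      have : ℓ ≤ Real.log (a₂ * s) := Real.log_le_log hQ0 ha₂
      rwa [Real.log_mul ha₂0.ne' hs0.ne', hlogs] at this
    have hden : 0 < Real.log a₂ + L / 2 := hℓpos.trans_le h1
    have h2 := hm L hLl
    -- `mlow ≤ L/(a₂ (log a₂ + L/2)) ≤ L/(a₂ ℓ) ≤ sL/(Q ℓ)`
    have h3 : mlow ≤ L / (a₂ * (Real.log a₂ + L / 2)) := by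
      rw [le_div_iff₀ (by positivity)]; exact h2
    have h4 : L / (a₂ * (Real.log a₂ + L / 2)) ≤ L / (a₂ * ℓ) :=
      div_le_div_of_nonneg_left hLpos.le (by positivity) (mul_le_mul_of_nonneg_left h1 ha₂0.le)
    have h5 : L / (a₂ * ℓ) ≤ m := by
      rw [hmdef, div_le_div_iff₀ (by positivity) (by positivity)]
      have h6 := mul_le_mul_of_nonneg_right ha₂ (by positivity : (0 : ℝ) ≤ L * ℓ)
      calc L * ((Q : ℝ) * ℓ) = (Q : ℝ) * (L * ℓ) := by ring
        _ ≤ a₂ * s * (L * ℓ) := h6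
        _ = s * L * (a₂ * ℓ) := by ring
    linarith
  have hm0' : 0 ≤ m := hm0.trans hm_ge
  -- multiply the tail bound by `sL`
  have hmain : ((1 - δ) * (ℓ / (ℓ + 1)) - 2 * δ) * m - (1 - δ) * (ℓ / (ℓ + 1)) / s ≤ S * (s * L) := by
    have e : ((1 - δ) * (ℓ / (ℓ + 1)) * (1 / ((Q : ℝ) * ℓ) - 1 / ((P : ℝ) * L)) - 2 * δ / ((Q : ℝ) * ℓ))
        * (s * L) = ((1 - δ) * (ℓ / (ℓ + 1)) - 2 * δ) * m - (1 - δ) * (ℓ / (ℓ + 1)) / s := by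
      rw [hmdef, ← hss]
      field_simp
      ring
    rw [← e]
    exact mul_le_mul_of_nonneg_right hG (by positivity)
  -- compare with the box
  have hfrac : ℓ₁ / (ℓ₁ + 1) ≤ ℓ / (ℓ + 1) := by
    rw [div_le_div_iff₀ (by positivity) (by positivity)]
    have e1 : ℓ₁ * (ℓ + 1) = ℓ₁ * ℓ + ℓ₁ := by ring
    have e2 : ℓ * (ℓ₁ + 1) = ℓ₁ * ℓ + ℓ := by ring
    rw [e1, e2]
    linarith
  have hfrac1 : ℓ / (ℓ + 1) ≤ 1 := by rw [div_le_one (by positivity)]; linarith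
  have hfrac0 : 0 ≤ ℓ / (ℓ + 1) := by positivity
  have hbr : (1 - d₁) * (ℓ₁ / (ℓ₁ + 1)) - 2 * d₁ ≤ (1 - δ) * (ℓ / (ℓ + 1)) - 2 * δ := by
    have h1 : (1 - d₁) * (ℓ₁ / (ℓ₁ + 1)) ≤ (1 - δ) * (ℓ / (ℓ + 1)) :=
      mul_le_mul (by linarith) hfrac (by positivity) (by linarith)
    linarith
  have hterm1 : ((1 - d₁) * (ℓ₁ / (ℓ₁ + 1)) - 2 * d₁) * mlow ≤ ((1 - δ) * (ℓ / (ℓ + 1)) - 2 * δ) * m :=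
    mul_le_mul hbr hm_ge hm0 (hκ.trans hbr)
  have hterm2 : (1 - δ) * (ℓ / (ℓ + 1)) / s ≤ 1 / s₁ := by
    have h1 : (1 - δ) * (ℓ / (ℓ + 1)) ≤ 1 := by
      calc (1 - δ) * (ℓ / (ℓ + 1)) ≤ 1 * (ℓ / (ℓ + 1)) :=
            mul_le_mul_of_nonneg_right (by linarith) hfrac0
        _ ≤ 1 := by linarith
    calc (1 - δ) * (ℓ / (ℓ + 1)) / s ≤ 1 / s := div_le_div_of_nonneg_right h1 hs0.le
      _ ≤ 1 / s₁ := div_le_div_of_nonneg_left zero_le_one hs₁0 hsl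
  unfold g2Box
  linarith

/-- `G1_mul_ge` on the window (proof verbatim, `theta_two_sided` ↦ `theta_two_sidedW` at `Q, P ≤ B`). -/
theorem G1_mul_geW {B : ℝ} (hW : (∀ y : ℝ, 599 ≤ y → y ≤ B → |θ y - y| ≤ √y * Real.log y ^ 2 / (8 * π))) {P Q : ℕ}
    {P₁ a₁ a₂ d₁ dP L₁ s₁ cR : ℝ}
    (hQ : 599 ≤ Q) (hQP : Q ≤ P) (hPB : (P : ℝ) ≤ B) (hPl : P₁ ≤ P) (hP₁ : 599 ≤ P₁)
    (ha₁ : a₁ * √(P : ℝ) ≤ Q) (ha₂ : (Q : ℝ) ≤ a₂ * √(P : ℝ)) (ha₁0 : 0 ≤ a₁) (ha₂0 : 0 < a₂)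
    (hd₁ : schoenfeldDelta (max 599 (a₁ * √P₁)) ≤ d₁) (hd₁1 : d₁ ≤ 1 / 2)
    (hdP : schoenfeldDelta P₁ ≤ dP)
    (hL₁ : L₁ ≤ Real.log P₁) (hL₁0 : 0 < L₁) (hs₁ : s₁ ≤ √P₁) (hs₁0 : 0 < s₁)
    (hcR : (1 + dP) + (1 + d₁) * a₂ / s₁ ≤ cR) :
    g1Box d₁ a₁ cR L₁ ≤
      θ Q / ((θ P + θ Q) * Real.log (θ P + θ Q)) * (√(P : ℝ) * Real.log P) := by
  have hQr : (599 : ℝ) ≤ Q := by exact_mod_cast hQ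
  have hQPr : (Q : ℝ) ≤ P := by exact_mod_cast hQP
  have hP0 : (0 : ℝ) < P := by linarith
  have hP₁0 : 0 < P₁ := by linarith
  have hQ0 : (0 : ℝ) < Q := by linarith
  have hP599 : (599 : ℝ) ≤ P := hQr.trans hQPr
  set L := Real.log (P : ℝ) with hL
  set s := √(P : ℝ) with hs
  set δQ := schoenfeldDelta Q with hδQ
  set δP := schoenfeldDelta P with hδP
  have hs0 : 0 < s := Real.sqrt_pos.2 hP0
  have hss : s * s = P := Real.mul_self_sqrt hP0.le
  have hLpos : 0 < L := Real.log_pos (by linarith)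
  have hLl : L₁ ≤ L := hL₁.trans (Real.log_le_log hP₁0 hPl)
  have hsl : s₁ ≤ s := hs₁.trans (Real.sqrt_le_sqrt hPl)
  -- θ bounds
  obtain ⟨hθQl, hθQu⟩ := theta_two_sidedW hW hQr le_rfl (hQPr.trans hPB)
  obtain ⟨hθPl, hθPu⟩ := theta_two_sidedW hW hP599 le_rfl hPB
  rw [← hδQ] at hθQl hθQu
  rw [← hδP] at hθPl hθPu
  have hmaxQ : max 599 (a₁ * √P₁) ≤ Q := by
    refine max_le hQr (le_trans ?_ ha₁)
    exact mul_le_mul_of_nonneg_left (Real.sqrt_le_sqrt hPl) ha₁0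
  have hδQd : δQ ≤ d₁ := (schoenfeldDelta_antitone (le_max_left _ _) hmaxQ).trans hd₁
  have hδQ0 : 0 ≤ δQ := schoenfeldDelta_nonneg _
  have hδPd : δP ≤ dP := (schoenfeldDelta_antitone hP₁ hPl).trans hdP
  have hδP0 : 0 ≤ δP := schoenfeldDelta_nonneg _
  have hδP1 : δP ≤ 0.0666 := schoenfeldDelta_le hP599
  -- `G₁ ≥ (1−δQ) Q/(R₁ log R₁)` with `R₁ = (1+δP)P + (1+δQ)Q`
  set R₁ := (1 + δP) * P + (1 + δQ) * Q with hR₁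
  have hd₁0 : 0 ≤ d₁ := (schoenfeldDelta_nonneg _).trans hd₁
  have hθP1 : 1 ≤ θ P := by
    have : (1 - 0.0666) * 599 ≤ (1 - δP) * (P : ℝ) :=
      mul_le_mul (by linarith) hP599 (by norm_num) (by linarith)
    linarith
  have hlow : 0 ≤ (1 - δQ) * Q := mul_nonneg (by linarith) hQ0.le
  have hG := G1_lower hθP1 (Chebyshev.theta_nonneg _) hθQl hlow (by linarith : θ P + θ Q ≤ R₁)
  -- `R₁ ≤ cR P`, `log R₁ ≤ L + (cR − 1)`
  have hcR1 : 1 ≤ cR := by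
    have : 0 ≤ (1 + d₁) * a₂ / s₁ := by
      have : 0 ≤ 1 + d₁ := by linarith
      positivity
    linarith
  have hR₁le : R₁ ≤ cR * P := by
    have h1 : (1 + δQ) * (Q : ℝ) ≤ (1 + d₁) * (a₂ * s) :=
      mul_le_mul (by linarith) ha₂ hQ0.le (by linarith)
    have h2 : (1 + d₁) * (a₂ * s) = ((1 + d₁) * a₂ / s) * P := by
      rw [← hss]; field_simp
    have h3 : (1 + d₁) * a₂ / s ≤ (1 + d₁) * a₂ / s₁ :=
      div_le_div_of_nonneg_left (mul_nonneg (by linarith) ha₂0.le) hs₁0 hsl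
    have h4 : (1 + δP) * (P : ℝ) ≤ (1 + dP) * P := mul_le_mul_of_nonneg_right (by linarith) hP0.le
    calc R₁ = (1 + δP) * P + (1 + δQ) * Q := rfl
      _ ≤ (1 + dP) * P + ((1 + d₁) * a₂ / s) * P := by rw [← h2]; linarith
      _ ≤ (1 + dP) * P + ((1 + d₁) * a₂ / s₁) * P := by
          have := mul_le_mul_of_nonneg_right h3 hP0.le
          linarith
      _ = ((1 + dP) + (1 + d₁) * a₂ / s₁) * P := by ring
      _ ≤ cR * P := mul_le_mul_of_nonneg_right hcR hP0.le
  have hPδ : (P : ℝ) ≤ (1 + δP) * P := by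
    have := mul_nonneg hδP0 hP0.le
    linarith [show (1 + δP) * (P : ℝ) = P + δP * P by ring]
  have hQδ : 0 ≤ (1 + δQ) * (Q : ℝ) := by positivity
  have hR₁1 : 1 ≤ R₁ := by
    simp only [hR₁]
    linarith
  have hlogR : R₁ * Real.log R₁ ≤ (cR * P) * (L + (cR - 1)) := by
    have h1 := mul_log_mono hR₁1 hR₁le
    have h2 : Real.log (cR * P) ≤ L + (cR - 1) := by
      rw [Real.log_mul (by positivity) hP0.ne']
      linarith [Real.log_le_sub_one_of_pos (by positivity : 0 < cR)]
    exact h1.trans (mul_le_mul_of_nonneg_left h2 (by positivity))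
  have hden0 : 0 < R₁ * Real.log R₁ := by
    have h : 1 < R₁ := by
      simp only [hR₁]
      linarith
    exact mul_pos (by linarith) (Real.log_pos h)
  -- `G₁ ≥ (1−d₁) a₁ s/((cR P)(L + cR − 1))`
  have hnum : (1 - d₁) * (a₁ * s) ≤ (1 - δQ) * Q := mul_le_mul (by linarith) ha₁ (by positivity) (by linarith)
  have hG2 : (1 - d₁) * (a₁ * s) / ((cR * P) * (L + (cR - 1))) ≤ (1 - δQ) * Q / (R₁ * Real.log R₁) := by
    calc (1 - d₁) * (a₁ * s) / ((cR * P) * (L + (cR - 1)))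
        ≤ (1 - d₁) * (a₁ * s) / (R₁ * Real.log R₁) :=
          div_le_div_of_nonneg_left (mul_nonneg (by linarith) (by positivity)) hden0 hlogR
      _ ≤ (1 - δQ) * Q / (R₁ * Real.log R₁) := div_le_div_of_nonneg_right hnum hden0.le
  -- multiply by `sL` and compare with the box
  have e : (1 - d₁) * (a₁ * s) / ((cR * P) * (L + (cR - 1))) * (s * L) =
      (1 - d₁) * a₁ / (cR * (1 + (cR - 1) / L)) := by
    rw [← hss]; field_simp
  have hbox : g1Box d₁ a₁ cR L₁ ≤ (1 - d₁) * a₁ / (cR * (1 + (cR - 1) / L)) := by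
    unfold g1Box
    apply div_le_div_of_nonneg_left (mul_nonneg (by linarith) ha₁0) (by
      have : 0 ≤ (cR - 1) / L := by apply div_nonneg <;> linarith
      positivity)
    apply mul_le_mul_of_nonneg_left _ (by linarith)
    have : (cR - 1) / L ≤ (cR - 1) / L₁ := div_le_div_of_nonneg_left (by linarith) hL₁0 hLl
    linarith
  calc g1Box d₁ a₁ cR L₁ ≤ (1 - d₁) * a₁ / (cR * (1 + (cR - 1) / L)) := hbox
    _ = (1 - d₁) * (a₁ * s) / ((cR * P) * (L + (cR - 1))) * (s * L) := e.symm
    _ ≤ (1 - δQ) * Q / (R₁ * Real.log R₁) * (s * L) :=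
        mul_le_mul_of_nonneg_right hG2 (by positivity)
    _ ≤ θ Q / ((θ P + θ Q) * Real.log (θ P + θ Q)) * (s * L) :=
        mul_le_mul_of_nonneg_right hG (by positivity)

end Summit.RiemannHypothesis.RiemannHypothesis.Theorems.Splittings.RobinFiniteE3

end
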